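import Summits.CriticalPhenomena.PercolationContinuityZ3.Theorems.Transplant.GrigorchukWitnessSlabProfile
import Summits.CriticalPhenomena.PercolationContinuityZ3.Theorems.Transplant.GrigorchukTimesZSlabStrictInequality
import Summits.CriticalPhenomena.PercolationContinuityZ3.Theorems.Transplant.AutCylinderGrowth
import Literature.Barriers.CriticalPhenomena.SubexponentialGrowthZdDischarge
import Literature.Probability.Percolation.SusceptibilityGammaOne
import HarnessLib

/-!
# Door D12, support item T7: every slab `𝔊 × [m, m+L]` of `Cay(𝔊 × ℤ; a,b,c,d,z)` has FINITE susceptibility AT `p_c(𝔊 × ℤ)` — KERNEL, unconditional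

Proof file (`--supports stmt-CriticalPhenomena-4575`), lane `prim-bschramm`, seat `prim-bschramm-gen-1` gen 11 (GEN pen); the Sketch-CARD-6 support item
«SlabSusceptFinite» (w-idea-2, 7ed9f11f :300: "the subtraction is legal because `X(L) < ∞`") = the legality of the Simon–Lieb / DCT-certificate iteration on the
slab (design desk #9231 (5), route (β)).  builds on p205010 (kernel theorem, internal audit signed; external expert review pending) — nothing in this file uses
p205010.  Def-free; no instance (the induced graph's local finiteness is installed with `haveI` from «AutCylinderGrowth» `AutCyl.locallyFinite_induce`), no
notation, no sorry, no `@[conjecture]`; NOTHING about `θ(p_c)` of `Cay(𝔊 × ℤ)` is claimed (finite SLAB susceptibility at the BULK critical point is a statement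
about the strictly subcritical slabs, O22); `gzCay_conj4` untouched.

CHAIN (all kernel): O22 «GrigorchukTimesZSlabStrictInequality» `gzCay_criticalProb_lt_slab` (`p_c(gzCay, x) < p_c(gzCay[𝔊 × [m, m+L]], x)`) + Antunović–Veselić /
Hutchcroft Thm. 6 DISCHARGED («SubexponentialGrowthZdDischarge» `AntunovicVeselic2008_finiteSusceptibility_holds`: connected + quasi-transitive + locally finite ⇒
`Σ_y P_p(x ↔ y)` summable for `p < p_c`) applied to the INDUCED SLAB GRAPH, whose structural inputs are typed here: it is connected (horizontal moves along the
height-`t` copy of `Cay(𝔊; a,b,c,d)`, vertical moves along `z`-edges inside `[m, m+L]`) and quasi-transitive (left `𝔊`-translations, T3 `exists_slabIso_leftMul`;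
representatives `(1, t)`, `t ∈ [m, m+L]`).

CONTENT (namespace `…Transplant.Grigorchuk.SlabSuscept`): `gzCay_adj_layer_at`, `slab_reachable_horizontal`, `slab_reachable_vertical`, **`slab_connected`**,
**`slab_isQuasiTransitive`**, **`slab_summable_real_openConn`**, **`slabSusceptFinite (m L x hx) : expClusterSize (gzCay.induce (slabSet m L)) ⟨x, hx⟩ (p_c x) ≠ ⊤`**.
[cite: AntunovicVeselic2007, Thm. 2 (p_T = p_H on quasi-transitive graphs)] [cite: Hutchcroft2016, Thm. 6] [cite: BenjaminiSchramm1996, Question 1; §2 (Cayley graphs)]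
[cite: MartineauSevero2019, Cor. 2.2]
-/

noncomputable section

namespace Summit.CriticalPhenomena.PercolationContinuityZ3.Theorems.Transplant

namespace Grigorchuk

namespace SlabSuscept

open SimpleGraph MeasureTheory Literature.Barriers.CriticalPhenomena Literature.Probability.Percolation SnowballSqueeze
open scoped Classical ENNReal

/-! ## §1 The induced slab graph is connected -/

/-- The height-`t` copy of an edge of `Cay(𝔊; a,b,c,d)` is an edge of `Cay(𝔊 × ℤ; a,b,c,d,z)`. [cite: BenjaminiSchramm1996, §2 (Cayley graphs)] -/
theorem gzCay_adj_layer_at {u w : ↥grigorchukGroup} (h : stdCay.Adj u w) (t : Multiplicative ℤ) : gzCay.Adj (u, t) (w, t) := by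
  obtain ⟨y, rfl⟩ := stdCay_adj_iff.1 h
  obtain ⟨y', hy'⟩ := exists_toP_eq_toG y
  refine gzCay_adj_iff.2 ⟨y', ?_⟩
  rw [hy', Prod.mk_mul_mk, mul_one]

/-- Horizontal moves: two vertices of the slab at the same height are joined inside the slab (the height-`t` copy of the connected graph `Cay(𝔊; a,b,c,d)`).
[cite: BenjaminiSchramm1996, §2 (Cayley graphs)] -/
theorem slab_reachable_horizontal (m : ℤ) (L : ℕ) {t : Multiplicative ℤ} (ht : Multiplicative.toAdd t ∈ Set.Icc m (m + L)) (g g' : ↥grigorchukGroup) :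
    (gzCay.induce (slabSet m L)).Reachable ⟨(g, t), ht⟩ ⟨(g', t), ht⟩ :=
  (stdCay_connected.preconnected g g').map
    (⟨fun v => ⟨(v, t), ht⟩, fun hadj => gzCay_adj_layer_at hadj t⟩ : stdCay →g gzCay.induce (slabSet m L))

/-- The point `(g, m + k)` of the slab `𝔊 × [m, m+L]`, `k ≤ L`. [folklore] -/
theorem mem_slabSet_of_le (m : ℤ) {L k : ℕ} (hk : k ≤ L) (g : ↥grigorchukGroup) :
    ((g, Multiplicative.ofAdd (m + (k : ℤ))) : GZ) ∈ slabSet m L := by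
  simp only [slabSet, Set.mem_setOf_eq, toAdd_ofAdd, Set.mem_Icc]
  constructor <;> omega

/-- Vertical moves: `(g, m) ↔ (g, m + k)` inside the slab for `k ≤ L` (along the `z`-edges). [cite: BenjaminiSchramm1996, §2 (Cayley graphs)] -/
theorem slab_reachable_vertical (m : ℤ) (L : ℕ) (g : ↥grigorchukGroup) :
    ∀ k : ℕ, ∀ hk : k ≤ L, (gzCay.induce (slabSet m L)).Reachable ⟨(g, Multiplicative.ofAdd (m + ((0 : ℕ) : ℤ))), mem_slabSet_of_le m (Nat.zero_le L) g⟩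
      ⟨(g, Multiplicative.ofAdd (m + (k : ℤ))), mem_slabSet_of_le m hk g⟩
  | 0, _ => Reachable.refl _
  | k + 1, hk => by
    refine (slab_reachable_vertical m L g k (Nat.le_of_succ_le hk)).trans (Adj.reachable ?_)
    show gzCay.Adj (g, Multiplicative.ofAdd (m + (k : ℤ))) (g, Multiplicative.ofAdd (m + ((k + 1 : ℕ) : ℤ)))
    have e : ((g, Multiplicative.ofAdd (m + ((k + 1 : ℕ) : ℤ))) : GZ) = (g, Multiplicative.ofAdd (m + (k : ℤ))) * L6.toP .s := by
      refine Prod.ext (by simp [L6.toP, zP]) ?_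
      show Multiplicative.ofAdd (m + ((k + 1 : ℕ) : ℤ)) = Multiplicative.ofAdd (m + (k : ℤ)) * Multiplicative.ofAdd 1
      rw [← ofAdd_add]; push_cast; ring_nf
    rw [e]
    exact gzCay_adj_mul _ .s

/-- **The induced slab graph `gzCay[𝔊 × [m, m+L]]` is connected** (hub `(1, m)`: vertical then horizontal moves). [cite: BenjaminiSchramm1996, §2 (Cayley graphs)] -/
theorem slab_connected (m : ℤ) (L : ℕ) : (gzCay.induce (slabSet m L)).Connected := by
  haveI : Nonempty (slabSet m L) := ⟨⟨_, mem_slabSet_of_le m (Nat.zero_le L) 1⟩⟩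
  have hub : ∀ u : slabSet m L, (gzCay.induce (slabSet m L)).Reachable ⟨((1 : ↥grigorchukGroup), Multiplicative.ofAdd (m + ((0 : ℕ) : ℤ))),
      mem_slabSet_of_le m (Nat.zero_le L) 1⟩ u := by
    rintro ⟨⟨g, t⟩, hu⟩
    have hu' : Multiplicative.toAdd t ∈ Set.Icc m (m + L) := hu
    obtain ⟨k, hk, hkt⟩ : ∃ k : ℕ, k ≤ L ∧ Multiplicative.toAdd t = m + (k : ℤ) :=
      ⟨(Multiplicative.toAdd t - m).toNat, by have := hu'.1; have := hu'.2; omega, by have := hu'.1; omega⟩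
    have ht : t = Multiplicative.ofAdd (m + (k : ℤ)) := by rw [← hkt, ofAdd_toAdd]
    subst ht
    exact ((slab_reachable_horizontal m L (mem_slabSet_of_le m (Nat.zero_le L) 1) 1 g)).trans (slab_reachable_vertical m L g k hk)
  exact ⟨fun u v => (hub u).symm.trans (hub v)⟩

/-! ## §2 The induced slab graph is quasi-transitive -/

/-- **`gzCay[𝔊 × [m, m+L]]` is quasi-transitive**: the left translations `(g, h) ↦ (c g, h)` are automorphisms (T3 `exists_slabIso_leftMul`) and move every vertex
to one of the `L+1` representatives `(1, t)`, `t ∈ [m, m+L]`. [cite: BenjaminiSchramm1996, §2 (almost transitive graphs)] -/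
theorem slab_isQuasiTransitive (m : ℤ) (L : ℕ) : IsQuasiTransitive (gzCay.induce (slabSet m L)) := by
  classical
  refine ⟨(Finset.range (L + 1)).image (fun k => if hk : k ≤ L then ⟨((1 : ↥grigorchukGroup), Multiplicative.ofAdd (m + (k : ℤ))), mem_slabSet_of_le m hk 1⟩
      else ⟨_, mem_slabSet_of_le m (Nat.zero_le L) 1⟩), fun v => ?_⟩
  obtain ⟨⟨g, t⟩, hv⟩ := v
  have hv' : Multiplicative.toAdd t ∈ Set.Icc m (m + L) := hv
  obtain ⟨k, hk, hkt⟩ : ∃ k : ℕ, k ≤ L ∧ Multiplicative.toAdd t = m + (k : ℤ) :=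
    ⟨(Multiplicative.toAdd t - m).toNat, by have := hv'.1; have := hv'.2; omega, by have := hv'.1; omega⟩
  obtain ⟨γ, hγ⟩ := exists_slabIso_leftMul m L g⁻¹
  refine ⟨γ, Finset.mem_image.2 ⟨k, Finset.mem_range.2 (by omega), ?_⟩⟩
  rw [dif_pos hk]
  apply Subtype.ext
  rw [hγ]
  refine Prod.ext (by simp) ?_
  show Multiplicative.ofAdd (m + (k : ℤ)) = 1 * t
  rw [one_mul, ← hkt, ofAdd_toAdd]

/-! ## §3 Finite susceptibility of every slab at the bulk critical point -/

/-- **Summability of the slab two-point function at `p_c(𝔊 × ℤ)`**: for `x ∈ 𝔊 × [m, m+L]`, `Σ_y P_{p_c(gzCay, x)}^{slab}(x ↔ y) < ∞` — the slab is strictly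
subcritical at the bulk critical point (O22 `gzCay_criticalProb_lt_slab`) and connected quasi-transitive locally finite graphs have finite susceptibility below their
critical point (Antunović–Veselić 2008 Thm. 2 / Hutchcroft 2016 Thm. 6, DISCHARGED in the tree). [cite: AntunovicVeselic2007, Thm. 2] [cite: Hutchcroft2016, Thm. 6]
[cite: MartineauSevero2019, Cor. 2.2] -/
theorem slab_summable_real_openConn (m : ℤ) (L : ℕ) (x : GZ) (hx : x ∈ slabSet m L) :
    Summable fun y : slabSet m L =>
      (bondPercolation (gzCay.induce (slabSet m L)) (criticalProbIOf gzCay x)).real (openConn (⟨x, hx⟩ : slabSet m L) y) := by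
  haveI := AutCyl.locallyFinite_induce (G := gzCay) (slabSet m L)
  exact AntunovicVeselic2008_finiteSusceptibility_holds (gzCay.induce (slabSet m L)) (slab_connected m L) (slab_isQuasiTransitive m L) ⟨x, hx⟩
    (criticalProbIOf gzCay x) (gzCay_criticalProb_lt_slab L m x hx)

/-- **T7 — every slab `𝔊 × [m, m+L]` has FINITE mean cluster size at the bulk critical point `p_c(Cay(𝔊 × ℤ))`** (KERNEL, unconditional):
`expClusterSize (gzCay[𝔊 × [m, m+L]]) x (p_c(gzCay, x)) < ∞`, i.e. `X(L) < ∞` for every `L` — the legality of the Simon–Lieb subtraction on the slab.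
[cite: AntunovicVeselic2007, Thm. 2] [cite: Hutchcroft2016, Thm. 6] [cite: BenjaminiSchramm1996, Question 1] -/
theorem slabSusceptFinite (m : ℤ) (L : ℕ) (x : GZ) (hx : x ∈ slabSet m L) :
    expClusterSize (gzCay.induce (slabSet m L)) ⟨x, hx⟩ (criticalProbIOf gzCay x) ≠ ⊤ := by
  haveI : Countable GZ := countable_of_connected_of_locallyFinite gzCay gzCay_connected x
  have hs := slab_summable_real_openConn m L x hx
  rw [expClusterSize_eq_tsum]
  have h : (fun y : slabSet m L => bondPercolation (gzCay.induce (slabSet m L)) (criticalProbIOf gzCay x) (openConn (⟨x, hx⟩ : slabSet m L) y)) =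
      fun y => ENNReal.ofReal ((bondPercolation (gzCay.induce (slabSet m L)) (criticalProbIOf gzCay x)).real (openConn (⟨x, hx⟩ : slabSet m L) y)) := by
    funext y; rw [ofReal_measureReal]
  rw [h, ← ENNReal.ofReal_tsum_of_nonneg (fun _ => measureReal_nonneg) hs]
  exact ENNReal.ofReal_ne_top

end SlabSuscept

end Grigorchuk

end Summit.CriticalPhenomena.PercolationContinuityZ3.Theorems.Transplant
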